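import Literature.Geometry.Lorentzian.CoordLaplacianPerturbation
import Literature.Geometry.Lorentzian.CoordMetricPairDivergence
import HarnessLib

/-!
# The derivatives of index raising and of the Christoffel map from the components; bounds

Pure Fréchet calculus in the `MetricCoord` framework (`CoordCurvature.lean`: `sharpAt`,
`koszulCLM`, `chrAt`, `riemAt`, `ricAt`; `CoordLaplacianPerturbation.lean`: operator bounds for
`♯`, `K`, `Γ`). For metric components `G` on an open `V` (`IsMetricOn G V`) we record the explicit
first derivatives entering the curvature `R = DΓ − DΓ + ΓΓ − ΓΓ` in terms of the jets
`(G, DG, D²G)` at the point, and the resulting operator bounds: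

* (from `CoordBianchi.lean`: `IsMetricOn.fderiv_sharpAt`, `D♯(v) = −♯ ∘ DG(v) ∘ ♯`, and its bound
  `IsMetricOn.norm_fderiv_sharpAt_apply_le` of `CoordMetricPairDivergence.lean`);
* `IsMetricOn.fderiv_chrAt_apply_eq` — **`DΓ(v)(X, ·) = ½ (D♯(v) ∘ K(X) + ♯ ∘ koszulOp(D²G(v))(X))`**
  (`Γ(X, ·) = ½ ♯ ∘ K(X)`, `K = koszulOp(DG)`, O'Neill 1983, Ch. 3, Prop. 3.13), with
  `norm_fderiv_chrAt_apply_le`: `‖DΓ(v)(X)‖ ≤ (3/2)(‖♯‖² ‖DG‖² + ‖♯‖ ‖D²G‖) ‖v‖ ‖X‖`;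
* `norm_riemAt_apply_le`, `abs_ricAt_le` — **`‖R(X,Y)Z‖ ≤ (2 C_{DΓ} + 2 C_Γ²) ‖X‖ ‖Y‖ ‖Z‖`** and
  `|Ric(Y,Z)| ≤ n (2 C_{DΓ} + 2 C_Γ²) ‖Y‖ ‖Z‖` in an inner product space of dimension `n`
  (`C_Γ = (3/2)‖♯‖‖DG‖`, `C_{DΓ} = (3/2)(‖♯‖²‖DG‖² + ‖♯‖‖D²G‖)`; the Ricci trace expanded in an
  orthonormal basis, `ricAt_eq_sum_coord`).

These are the single-metric bounds of the `C²`-perturbation estimate for the Ricci tensor (the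
step comparing the Ricci tensor of an `ε`-neck with that of the model cylinder, R. Hamilton,
Comm. Anal. Geom. 5 (1997), §C2; `Lorentzian/CoordCylinderRicci.lean`). Everything is proved;
no definitions, no named facts.

## References

* B. O'Neill, *Semi-Riemannian geometry*, Academic Press 1983, Ch. 3, p. 60, Prop. 3.13,
  Lemma 3.38, Lemma 3.52. [ONeill1983]
* R. S. Hamilton, *Four-manifolds with positive isotropic curvature*, Comm. Anal. Geom. 5 (1997),
  §C2, p. 31. [Hamilton1997]
-/

noncomputable section

set_option maxSynthPendingDepth 3

open Set Filter ContinuousLinearMap Module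
open scoped Topology ContDiff RealInnerProductSpace

namespace Literature.Geometry.Lorentzian

namespace MetricCoord

section Derivatives

variable {E : Type*} [NormedAddCommGroup E] [NormedSpace ℝ E] [CompleteSpace E]
  {G : E → E →L[ℝ] E →L[ℝ] ℝ} {V : Set E} {x : E}

/-- **The derivative of the Christoffel map**:
`DΓ(x)(v)(X, ·) = ½ (D♯(x)(v) ∘ K_x(X) + ♯ₓ ∘ koszulOp(D²G(x)(v))(X))` — differentiate
`Γ_y(X, ·) = ½ ♯_y ∘ K_y(X)` (`chrAt_apply_eq_comp`) with `DK(x)(v) = koszulOp(D²G(x)(v))`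
(`IsMetricOn.fderiv_koszulCLM`). [cite: ONeill1983, Ch. 3, Prop. 3.13] -/
theorem IsMetricOn.fderiv_chrAt_apply_eq (hG : IsMetricOn G V) (hx : x ∈ V) (v X : E) :
    fderiv ℝ (chrAt G) x v X =
      (2⁻¹ : ℝ) • ((fderiv ℝ (sharpAt G) x v).comp (koszulCLM G x X)
        + (sharpAt G x).comp (koszulOp (fderiv ℝ (fderiv ℝ G) x v) X)) := by
  rw [← hG.fderiv_chrAt_apply hx X v]
  have hfun : (fun y ↦ chrAt G y X) = fun y ↦ (2⁻¹ : ℝ) • (sharpAt G y).comp (koszulCLM G y X) :=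
    funext fun y ↦ chrAt_apply_eq_comp X
  rw [hfun]
  have hS : DifferentiableAt ℝ (sharpAt G) x := hG.differentiableAt_sharpAt hx
  have hK : DifferentiableAt ℝ (koszulCLM G) x := hG.differentiableAt_koszulCLM hx
  have hKX : DifferentiableAt ℝ (fun y ↦ koszulCLM G y X) x := differentiableAt_clm_apply_const hK X
  have hcomp : DifferentiableAt ℝ (fun y ↦ (sharpAt G y).comp (koszulCLM G y X)) x := hS.clm_comp hKX
  rw [fderiv_fun_const_smul hcomp, smul_apply, fderiv_clm_comp hS hKX]
  congr 1
  simp only [add_apply, ContinuousLinearMap.comp_apply,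
    ContinuousLinearMap.compL_apply, ContinuousLinearMap.flip_apply]
  rw [fderiv_clm_apply_const hK X v, hG.fderiv_koszulCLM hx, add_comm]

omit [CompleteSpace E] in
/-- `‖koszulOp T (X)‖ ≤ 3 ‖T‖ ‖X‖`, restated for the operator applied to `D²G(x)(v)`:
`‖koszulOp(D²G(v))(X)‖ ≤ 3 ‖D²G‖ ‖v‖ ‖X‖`. [folklore] -/
theorem norm_koszulOp_fderiv_fderiv_apply_le (v X : E) :
    ‖koszulOp (fderiv ℝ (fderiv ℝ G) x v) X‖ ≤ 3 * ‖fderiv ℝ (fderiv ℝ G) x‖ * ‖v‖ * ‖X‖ := by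
  calc ‖koszulOp (fderiv ℝ (fderiv ℝ G) x v) X‖
      ≤ 3 * ‖fderiv ℝ (fderiv ℝ G) x v‖ * ‖X‖ := norm_koszulOp_apply_le _ X
    _ ≤ 3 * (‖fderiv ℝ (fderiv ℝ G) x‖ * ‖v‖) * ‖X‖ := by
        gcongr; exact (fderiv ℝ (fderiv ℝ G) x).le_opNorm v
    _ = 3 * ‖fderiv ℝ (fderiv ℝ G) x‖ * ‖v‖ * ‖X‖ := by ring

/-- **`‖DΓ(v)(X)‖ ≤ (3/2) (‖♯‖² ‖DG‖² + ‖♯‖ ‖D²G‖) ‖v‖ ‖X‖`**. [folklore] -/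
theorem IsMetricOn.norm_fderiv_chrAt_apply_le (hG : IsMetricOn G V) (hx : x ∈ V) (v X : E) :
    ‖fderiv ℝ (chrAt G) x v X‖ ≤
      2⁻¹ * (3 * (‖sharpAt G x‖ ^ 2 * ‖fderiv ℝ G x‖ ^ 2
        + ‖sharpAt G x‖ * ‖fderiv ℝ (fderiv ℝ G) x‖)) * ‖v‖ * ‖X‖ := by
  rw [hG.fderiv_chrAt_apply_eq hx, norm_smul, Real.norm_eq_abs, abs_of_pos (by norm_num : (0 : ℝ) < 2⁻¹)]
  have h1' : ‖fderiv ℝ (sharpAt G) x v‖ ≤ ‖sharpAt G x‖ ^ 2 * ‖fderiv ℝ G x‖ * ‖v‖ := by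
    have := hG.norm_fderiv_sharpAt_apply_le hx v
    calc ‖fderiv ℝ (sharpAt G) x v‖
        ≤ ‖sharpAt G x‖ * ‖fderiv ℝ G x‖ * ‖sharpAt G x‖ * ‖v‖ := this
      _ = ‖sharpAt G x‖ ^ 2 * ‖fderiv ℝ G x‖ * ‖v‖ := by ring
  have h1 : ‖(fderiv ℝ (sharpAt G) x v).comp (koszulCLM G x X)‖ ≤
      ‖sharpAt G x‖ ^ 2 * ‖fderiv ℝ G x‖ * ‖v‖ * (3 * ‖fderiv ℝ G x‖ * ‖X‖) :=
    (opNorm_comp_le _ _).trans (mul_le_mul h1'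
      (norm_koszulCLM_apply_le X) (norm_nonneg _) (by positivity))
  have h2 : ‖(sharpAt G x).comp (koszulOp (fderiv ℝ (fderiv ℝ G) x v) X)‖ ≤
      ‖sharpAt G x‖ * (3 * ‖fderiv ℝ (fderiv ℝ G) x‖ * ‖v‖ * ‖X‖) :=
    (opNorm_comp_le _ _).trans (mul_le_mul_of_nonneg_left
      (norm_koszulOp_fderiv_fderiv_apply_le v X) (norm_nonneg _))
  have h3 := (norm_add_le _ _).trans (add_le_add h1 h2)
  calc 2⁻¹ * ‖(fderiv ℝ (sharpAt G) x v).comp (koszulCLM G x X)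
          + (sharpAt G x).comp (koszulOp (fderiv ℝ (fderiv ℝ G) x v) X)‖
      ≤ 2⁻¹ * (‖sharpAt G x‖ ^ 2 * ‖fderiv ℝ G x‖ * ‖v‖ * (3 * ‖fderiv ℝ G x‖ * ‖X‖)
          + ‖sharpAt G x‖ * (3 * ‖fderiv ℝ (fderiv ℝ G) x‖ * ‖v‖ * ‖X‖)) :=
        mul_le_mul_of_nonneg_left h3 (by norm_num)
    _ = 2⁻¹ * (3 * (‖sharpAt G x‖ ^ 2 * ‖fderiv ℝ G x‖ ^ 2
          + ‖sharpAt G x‖ * ‖fderiv ℝ (fderiv ℝ G) x‖)) * ‖v‖ * ‖X‖ := by ring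

/-- **Bound on the curvature endomorphism from the jets**:
`‖R(X, Y)Z‖ ≤ (2 C_{DΓ} + 2 C_Γ²) ‖X‖ ‖Y‖ ‖Z‖` with `C_Γ = (3/2) ‖♯‖ ‖DG‖` and
`C_{DΓ} = (3/2) (‖♯‖² ‖DG‖² + ‖♯‖ ‖D²G‖)` (`R = DΓ − DΓ + ΓΓ − ΓΓ`, `riemAt_apply`).
[cite: ONeill1983, Ch. 3, Lemma 3.38] -/
theorem IsMetricOn.norm_riemAt_apply_le (hG : IsMetricOn G V) (hx : x ∈ V) (X Y Z : E) :
    ‖riemAt G x X Y Z‖ ≤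
      (2 * (2⁻¹ * (3 * (‖sharpAt G x‖ ^ 2 * ‖fderiv ℝ G x‖ ^ 2
          + ‖sharpAt G x‖ * ‖fderiv ℝ (fderiv ℝ G) x‖)))
        + 2 * (2⁻¹ * (‖sharpAt G x‖ * (3 * ‖fderiv ℝ G x‖))) ^ 2) * ‖X‖ * ‖Y‖ * ‖Z‖ := by
  set CD : ℝ := 2⁻¹ * (3 * (‖sharpAt G x‖ ^ 2 * ‖fderiv ℝ G x‖ ^ 2
    + ‖sharpAt G x‖ * ‖fderiv ℝ (fderiv ℝ G) x‖)) with hCD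
  set CG : ℝ := 2⁻¹ * (‖sharpAt G x‖ * (3 * ‖fderiv ℝ G x‖)) with hCG
  have hCD0 : 0 ≤ CD := by positivity
  have hCG0 : 0 ≤ CG := by positivity
  have hDΓ : ∀ v W : E, ‖fderiv ℝ (chrAt G) x v W‖ ≤ CD * ‖v‖ * ‖W‖ := fun v W ↦
    hG.norm_fderiv_chrAt_apply_le hx v W
  have hΓ : ∀ W : E, ‖chrAt G x W‖ ≤ CG * ‖W‖ := fun W ↦ by
    have := norm_chrAt_apply_le (G := G) (y := x) W
    rw [hCG]; nlinarith [this, norm_nonneg W, norm_nonneg (sharpAt G x), norm_nonneg (fderiv ℝ G x)]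
  -- the four terms
  have t1 : ‖fderiv ℝ (chrAt G) x X Y Z‖ ≤ CD * ‖X‖ * ‖Y‖ * ‖Z‖ :=
    ((fderiv ℝ (chrAt G) x X Y).le_opNorm Z).trans (by
      have := hDΓ X Y; nlinarith [norm_nonneg Z])
  have t2 : ‖fderiv ℝ (chrAt G) x Y X Z‖ ≤ CD * ‖X‖ * ‖Y‖ * ‖Z‖ :=
    ((fderiv ℝ (chrAt G) x Y X).le_opNorm Z).trans (by
      have := hDΓ Y X; nlinarith [norm_nonneg Z])
  have t3 : ‖chrAt G x X (chrAt G x Y Z)‖ ≤ CG ^ 2 * ‖X‖ * ‖Y‖ * ‖Z‖ := by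
    calc ‖chrAt G x X (chrAt G x Y Z)‖ ≤ ‖chrAt G x X‖ * ‖chrAt G x Y Z‖ := (chrAt G x X).le_opNorm _
      _ ≤ (CG * ‖X‖) * (‖chrAt G x Y‖ * ‖Z‖) := by
          gcongr
          · exact hΓ X
          · exact (chrAt G x Y).le_opNorm Z
      _ ≤ (CG * ‖X‖) * (CG * ‖Y‖ * ‖Z‖) := by gcongr; exact hΓ Y
      _ = CG ^ 2 * ‖X‖ * ‖Y‖ * ‖Z‖ := by ring
  have t4 : ‖chrAt G x Y (chrAt G x X Z)‖ ≤ CG ^ 2 * ‖X‖ * ‖Y‖ * ‖Z‖ := by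
    calc ‖chrAt G x Y (chrAt G x X Z)‖ ≤ ‖chrAt G x Y‖ * ‖chrAt G x X Z‖ := (chrAt G x Y).le_opNorm _
      _ ≤ (CG * ‖Y‖) * (‖chrAt G x X‖ * ‖Z‖) := by
          gcongr
          · exact hΓ Y
          · exact (chrAt G x X).le_opNorm Z
      _ ≤ (CG * ‖Y‖) * (CG * ‖X‖ * ‖Z‖) := by gcongr; exact hΓ X
      _ = CG ^ 2 * ‖X‖ * ‖Y‖ * ‖Z‖ := by ring
  rw [riemAt_apply]
  calc ‖fderiv ℝ (chrAt G) x X Y Z - fderiv ℝ (chrAt G) x Y X Z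
        + chrAt G x X (chrAt G x Y Z) - chrAt G x Y (chrAt G x X Z)‖
      ≤ ‖fderiv ℝ (chrAt G) x X Y Z‖ + ‖fderiv ℝ (chrAt G) x Y X Z‖
        + ‖chrAt G x X (chrAt G x Y Z)‖ + ‖chrAt G x Y (chrAt G x X Z)‖ := by
          refine (norm_sub_le _ _).trans (add_le_add ((norm_add_le _ _).trans
            (add_le_add (norm_sub_le _ _) le_rfl)) le_rfl)
    _ ≤ (2 * CD + 2 * CG ^ 2) * ‖X‖ * ‖Y‖ * ‖Z‖ := by nlinarith [t1, t2, t3, t4]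

end Derivatives

/-! ### The Ricci trace in an orthonormal basis -/

section RicciBound

variable {E : Type*} [NormedAddCommGroup E] [InnerProductSpace ℝ E] [FiniteDimensional ℝ E]
  [CompleteSpace E] {G : E → E →L[ℝ] E →L[ℝ] ℝ} {V : Set E} {x : E}

omit [CompleteSpace E] in
/-- **The Ricci form in an orthonormal basis**: `Ric(Y, Z) = ∑ᵢ ⟪bᵢ, R(bᵢ, Y)Z⟫`
(`ricAt_eq_sum_coord` with `bⁱ = ⟪bᵢ, ·⟫`). [cite: ONeill1983, Ch. 3, Lemma 3.52] -/
theorem ricAt_eq_sum_inner {ι : Type*} [Fintype ι] (b : OrthonormalBasis ι ℝ E) (Y Z : E) :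
    ricAt G x Y Z = ∑ i, ⟪b i, riemAt G x (b i) Y Z⟫ := by
  rw [ricAt_eq_sum_coord b.toBasis]
  refine Finset.sum_congr rfl fun i _ ↦ ?_
  rw [OrthonormalBasis.coe_toBasis, coord_toBasis_apply]

/-- **Bound on the Ricci form from the jets**:
`|Ric(Y, Z)| ≤ n (2 C_{DΓ} + 2 C_Γ²) ‖Y‖ ‖Z‖`, `n = dim E` (each term `|⟪bᵢ, R(bᵢ,Y)Z⟫| ≤ ‖R(bᵢ,Y)Z‖`
with `‖bᵢ‖ = 1`). [cite: ONeill1983, Ch. 3, Lemma 3.52] -/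
theorem IsMetricOn.abs_ricAt_le (hG : IsMetricOn G V) (hx : x ∈ V) (Y Z : E) :
    |ricAt G x Y Z| ≤ Module.finrank ℝ E *
      ((2 * (2⁻¹ * (3 * (‖sharpAt G x‖ ^ 2 * ‖fderiv ℝ G x‖ ^ 2
          + ‖sharpAt G x‖ * ‖fderiv ℝ (fderiv ℝ G) x‖)))
        + 2 * (2⁻¹ * (‖sharpAt G x‖ * (3 * ‖fderiv ℝ G x‖))) ^ 2) * ‖Y‖ * ‖Z‖) := by
  set b := stdOrthonormalBasis ℝ E with hb
  set C : ℝ := (2 * (2⁻¹ * (3 * (‖sharpAt G x‖ ^ 2 * ‖fderiv ℝ G x‖ ^ 2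
      + ‖sharpAt G x‖ * ‖fderiv ℝ (fderiv ℝ G) x‖)))
    + 2 * (2⁻¹ * (‖sharpAt G x‖ * (3 * ‖fderiv ℝ G x‖))) ^ 2) with hC
  rw [ricAt_eq_sum_inner b]
  have hterm : ∀ i, |⟪b i, riemAt G x (b i) Y Z⟫| ≤ C * ‖Y‖ * ‖Z‖ := by
    intro i
    have h1 := abs_real_inner_le_norm (b i) (riemAt G x (b i) Y Z)
    rw [b.orthonormal.1 i, one_mul] at h1
    have h2 := hG.norm_riemAt_apply_le hx (b i) Y Z
    rw [b.orthonormal.1 i, mul_one] at h2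
    exact h1.trans h2
  calc |∑ i, ⟪b i, riemAt G x (b i) Y Z⟫|
      ≤ ∑ i, |⟪b i, riemAt G x (b i) Y Z⟫| := Finset.abs_sum_le_sum_abs _ _
    _ ≤ ∑ _i : Fin (Module.finrank ℝ E), C * ‖Y‖ * ‖Z‖ := Finset.sum_le_sum fun i _ ↦ hterm i
    _ = Module.finrank ℝ E * (C * ‖Y‖ * ‖Z‖) := by
        rw [Finset.sum_const, Finset.card_univ, Fintype.card_fin, nsmul_eq_mul]

end RicciBound

end MetricCoord

end Literature.Geometry.Lorentzian

end
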